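import Summits.QuantumFields.YangMills.Theorems.UnitScaleTiltProp7B8Prop7Div
import HarnessLib

/-!
# Route `UnitScaleTilt`, crux K1 child «MinimiserStabilityRegPr» (stmt-QuantumFields-19200), skeleton birth_v8 5b4e8467… — THE REGISTERED STUB `stub_PV3D`
# (v8 row (D): the p. 299 return to (18) in print's regime, [Balaban1985RegularSpaces] Prop. 7 at the T³ carriers) PROVED BY NAME AND SIGNATURE

Cell `ym3-torus`, width seat `ym-ust-19200-w2` (gen 0; OWNER RULING g24-№1 A2′; skeleton v8 of record C4a 2026-08-27 23:42Z).  YM₃ on T³ is a ladder rung (R3), not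
the Clay problem; nothing here is a claim about the crux `MinimiserStabilityRegPr` itself, d = 4 or the mass gap: the v8 composition still waits on `stub_halvingStep`,
`stub_PV3A`, `stub_PV3C`, `stub_PV3E`.

THE PROOF.  `Prop7B8Prop7Div.rowD_sPrint` (the text for every `L`, `T`, `B₃`): seat w1's `CritLPrint` is the chart image of a configuration critical in reading R2
(`Prop7PV3CDEAtSPrint.critLPrint_chart`), print's regular space is gauge invariant (`T3PrintedRegularOrbits.regPr_gaugeAct_iff`), and `U₁U₀ ∈ 𝔘_k(178ε₂)` for `U₁` in
(19) at `ε₂ ≤ ¼` over `U₀ ∈ 𝔘_k(L³B₃ε₁)`, `L³B₃ε₁ ≤ ε₂` (`Prop7B8Prop7Div.regPr_emb15_of_in19`: plaquette clause = [Balaban1985RegularSpaces] (1.47), divergence clause =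
the per-term estimate of (1.2) summed, `Prop7B8Prop7DivTerm`).  The Sect. C–E tail `T₀` is immaterial (the statement is T-free) and is taken trivial, as in the pen.

WHAT IS PROVED (sorry-free, no definition): **`stub_PV3D`** — the registered text verbatim (`O₂ = 178`, `c = ¼`).

References: T. Bałaban, CMP 102 (1985) 277–309 [Balaban1985Variational] (p.299, (18)–(19) pp.280–281, (2) p.278); CMP 99 (1985) 75–102 [Balaban1985RegularSpaces]
(Prop. 7 (1.144) p.100, (1.47) p.84, (1.9) p.77).
-/

noncomputable section

namespace Summit.QuantumFields.YangMills.Theorems.PV3D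

open MeasureTheory Filter Topology
open scoped Matrix.Norms.L2Operator
open Literature.MathematicalPhysics.QuantumFieldTheory.Balaban1983to89
open Literature.MathematicalPhysics.QuantumFieldTheory.Balaban1983to89.T3ContinuumYM3Torus
open Literature.MathematicalPhysics.QuantumFieldTheory.Balaban1983to89.T3UnitLawDensityEML (ℰp measurableE_ℰp)
open Literature.MathematicalPhysics.QuantumFieldTheory.Balaban1983to89.T3UnitScaleTilt
open Literature.MathematicalPhysics.QuantumFieldTheory.Balaban1983to89.T3TiltDescent
open Literature.MathematicalPhysics.QuantumFieldTheory.Balaban1983to89.T3CruxEstimates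
open Literature.MathematicalPhysics.QuantumFieldTheory.Balaban1983to89.T3ConstrainedMinimiser
open Literature.MathematicalPhysics.QuantumFieldTheory.Balaban1983to89.T3DescentFibreTower
open Literature.MathematicalPhysics.QuantumFieldTheory.Balaban1983to89.T3RegularMinimiser
open Literature.MathematicalPhysics.QuantumFieldTheory.Balaban1983to89.T3PrintedRegularMinimiser
open Literature.MathematicalPhysics.QuantumFieldTheory.Balaban1983to89.T3Thm1Carrier
open Literature.MathematicalPhysics.QuantumFieldTheory.Balaban1983to89.T3Thm1CarrierNative (IsCritR2 Prop7From14At)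
open Literature.MathematicalPhysics.QuantumFieldTheory.Balaban1983to89.T3SectALandauChart (ResidFam famLG3 In19 CloseAvg emb15)
open Summit.QuantumFields.YangMills.Theorems.Prop7TPrint (tPrintFam nMax19 expHermField)
open Summit.QuantumFields.YangMills.Theorems.Prop7SPrint (sPrint IsAxialPrint RestrictedPrint AvgCondPrint IsLandauPrint CritLPrint)

/-- **THE REGISTERED STUB `stub_PV3D` OF SKELETON v8 (row (D): [Balaban1985Variational] p. 299 «Proposition 7 [6] implies that U_k belongs to the space (18) with
ε₀ = O(1)C₁B₃ε₁. It is a critical configuration of the functional (5)», in print's regime `L³B₃ε₁ ≤ ε₂ ≤ c`) — PROVED**, with `O₂ = 178`, `c = ¼`, for every `L`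
and `B₃` (the registered binders `1 < L`, `4 < B₃` are not even used): `Prop7B8Prop7Div.rowD_sPrint` at a trivial Sect. C–E tail.
[cite: Balaban1985Variational, p.299 (before (141)), (18)-(19) pp.280-281; Balaban1985RegularSpaces, Prop. 7 (1.144) p.100, (1.47) p.84] -/
theorem stub_PV3D : ∀ (L : ℕ), 1 < L → ∀ (B₃ : ℝ), 4 < B₃ →
    ∃ O₂ c : ℝ, 1 ≤ O₂ ∧ 0 < c ∧ ∀ (i : Idx L) (ε₁ ε₂ : ℝ) (V : GaugeField (i.1.1.P i.1.2.1) 0 (Matrix.specialUnitaryGroup (Fin 2) ℂ))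
      (U₀ U₁ : GaugeField (i.1.1.P i.1.2.2) 0 (Matrix.specialUnitaryGroup (Fin 2) ℂ)) (X : PBond (i.1.1.P i.1.2.2) 0 → Matrix (Fin 2) (Fin 2) ℂ),
      (L : ℝ) ^ 3 * B₃ * ε₁ ≤ ε₂ → ε₂ ≤ c → RegPr i.1.1 i.1.2.1 i.1.2.2 ((L : ℝ) ^ 3 * B₃ * ε₁) U₀ → CloseAvg i.1.1 i.1.2.1 i.1.2.2 i.2.2.le ((L : ℝ) ^ 3 * ε₁) V U₀ →
      In19 i.1.1 i.1.2.1 i.1.2.2 ε₂ U₀ U₁ X → AvgCondPrint i.1.1 i.1.2.1 i.1.2.2 i.2.2.le V U₀ X → IsLandauPrint i.1.1 i.1.2.1 i.1.2.2 U₀ X →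
      CritLPrint i.1.1 i.1.2.1 i.1.2.2 i.2.2.le V U₀ U₁ →
        ∃ u : GaugeTransf (i.1.1.P i.1.2.2) 0 (Matrix.specialUnitaryGroup (Fin 2) ℂ), RestrictedPrint i.1.1 i.1.2.1 i.1.2.2 U₀ u ∧
          RegPr i.1.1 i.1.2.1 i.1.2.2 (O₂ * ε₂) (GaugeField.gaugeAct u (emb15 U₀ U₁)) ∧
          GaugeField.gaugeAct u (emb15 U₀ U₁) ∈ fibre i.1.1 ℰp i.1.2.1 i.1.2.2 i.2.2.le V ∧
          IsCritR2 i.1.1 i.1.2.1 i.1.2.2 i.2.2.le V (GaugeField.gaugeAct u (emb15 U₀ U₁)) := by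
  intro L _hL B₃ _hB₃
  -- a Sect. C–E tail (immaterial: the statement is over w1's T-free letters)
  let T₀ : ResidFam L := fun i =>
    { IsAxial := fun _ _ => True, Restricted := fun _ _ => True, AvgCond := fun _ _ _ => True, IsLandau := fun _ _ => True,
      CritL := fun _ _ _ => True, In43 := fun _ _ _ => True, nM1 := fun _ _ => 0, Def47 := fun _ _ => True, T47 := fun _ X => X,
      normD := fun _ _ => 0, kerD := fun _ _ _ _ => 0, nMax := fun _ _ => 0, dVn := fun _ _ => 0, dVAnalytic := fun _ _ => True,
      Sol111 := fun _ _ _ => True, T112 := fun _ U₀ _ => U₀, LikeH1B := fun _ _ _ => True, Sol111G := fun _ _ _ => True,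
      SolAnalytic := fun _ _ _ => True }
  exact Summit.QuantumFields.YangMills.Theorems.Prop7B8Prop7Div.rowD_sPrint T₀ B₃

end Summit.QuantumFields.YangMills.Theorems.PV3D

end
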